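import Summits.AtomisticToContinuum.FouriersLaw.Theorems.HonestZwanzigPositiveMemoryFloorOfBackflowFloor
import Summits.AtomisticToContinuum.FouriersLaw.Theorems.HonestZwanzigPositiveMemoryRowLimit
import Summits.AtomisticToContinuum.FouriersLaw.Theorems.HonestZwanzigOrthogonalOhmFeshbachIdentities
import Summits.AtomisticToContinuum.FouriersLaw.Theorems.HonestZwanzigPositiveMemoryBackflowFloorOfOrthogonalOhm

/-!
# HonestZwanzig / PositiveMemory — the split glue `ConductanceLowerBound → BulkBackflowFloor → PositiveMemory`

Strategist file for crux `stmt-AtomisticToContinuum-12694` (`HonestZwanzig.PositiveMemory`, rank 3 of route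
`HonestZwanzig`, sub-problem `FouriersLaw`). Nine lead cycles on line `Sketch` (skeleton v9, sorry-free, 19/19 stubs
landed) and three disprover generations agree that the crux has NO content independent of

* the summit's shared NOT-INSULATING item `JunctionLocality.ConductanceLowerBound` (stmt-AtomisticToContinuum-11749,
  `liminf_N D_N > 0`), and
* ONE one-sided `N`-uniform homogenisation statement strictly weaker than crux #2 `OrthogonalOhm`: the BULK BACKFLOW
  FLOOR — on `R(δ)`-bulk bonds any pair of limits `ρ = lim_{s↓0} schur_s(j_b,J)`, `ℓ = lim_{s↓0} lap_s(j_b,J)` has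
  `ρ ≥ ℓ − δ` (the Feshbach backflow `a_bᵀG(s)⁻¹A` is not macroscopically negative away from the contact layer).

This file records the typed split as ONE sorry-free implication over landed theorems, in the shape the gate's
`route edit --split PositiveMemory --into ConductanceLowerBound BulkBackflowFloor --glue-by …` consumes
(authored by strategist s4 as `Cruxes/PositiveMemory/StrategistSplit.lean`, 2026-08-17; landed verbatim under `Theorems/`
by the line lead c7 at the strategist's request, `Cruxes/PositiveMemory/SPLIT-READY.md`, so that the glue-by is a Theorems decl):

* `PositiveMemory_of_subs : ConductanceLowerBound → BulkBackflowFloor → PositiveMemory` — Kirchhoff flatness of the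
  unprojected responses (`stub_rowLimit`, p122092, fed the landed `stub_feshbachIdentities`) + the floor lemma
  `stub_positiveMemory_of_backflowFloor` (p122052: `ℓ = ∫₀^∞corr(J,J)/(N−1) ≥ cT²` by the Green–Kubo floor, then
  `ρ ≥ ℓ − cT²/2`, `k₀ = cT²/2`);
* `bulkBackflowFloor_of_orthogonalOhm : OrthogonalOhm → BulkBackflowFloor` — the second child is implied by crux #2
  (`stub_backflowFloor_of_orthogonalOhm`, p122152), so it closes by this one-liner the moment stmt-12693 lands, and
  the parent then closes by `PositiveMemory_of_subs`.

The second hypothesis of `PositiveMemory_of_subs` is spelled out verbatim (it becomes the route decl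
`HonestZwanzig.BulkBackflowFloor`); the first is the shared decl `JunctionLocality.ConductanceLowerBound` by name (the
route's child `HonestZwanzig.ConductanceLowerBound` carries the identical signature, so the gate's `…GlueBy_holds`
elaborates by unfolding, as for `CageBudgetFekete.AbelThermodynamicLimitGlueBy_holds`). No definitions, no named facts,
no `sorry`.
-/

noncomputable section

open MeasureTheory Finset Real Set Filter Topology
open Literature.MathematicalPhysics.KineticTheory.HeatConduction

namespace Summit.AtomisticToContinuum.FouriersLaw.Theorems.HonestZwanzig.PositiveMemory

/-- **Split glue for crux #3 of `HonestZwanzig`** (strategist, 2026-08-17): NOT-INSULATING (the shared item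
stmt-AtomisticToContinuum-11749, `JunctionLocality.ConductanceLowerBound`) and the BULK BACKFLOW FLOOR (one-sided,
existence-guarded, `N`-uniform; strictly weaker than `OrthogonalOhm`) imply `PositiveMemory` with `k₀ = cT²/2`.
Composition of the landed `stub_rowLimit` (p122092), `stub_feshbachIdentities` and
`stub_positiveMemory_of_backflowFloor` (p122052). -/
theorem PositiveMemory_of_subs :
    Summit.AtomisticToContinuum.FouriersLaw.Theses.JunctionLocality.ConductanceLowerBound →
    (∀ ω₂ lam β γ : ℝ, 0 < ω₂ → 0 < lam → 0 < β → 0 < γ → ∀ T : ℝ, 0 < T → ∀ δ : ℝ, 0 < δ → ∃ R : ℕ, ∀ N : ℕ, 2 ≤ N →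
    let P := Literature.MathematicalPhysics.KineticTheory.HeatConduction.pinnedChain ω₂ lam β γ;
    let X := Literature.MathematicalPhysics.KineticTheory.HeatConduction.PhaseSpace N;
    let μ : MeasureTheory.Measure X := P.gibbsMeasure N T;
    let corr : (X → ℝ) → (X → ℝ) → ℝ → ℝ := fun f g t =>
      (∫ z, f z * (∫ y, g y ∂(P.transitionKernel N T T t.toNNReal z)) ∂μ) - (∫ z, f z ∂μ) * (∫ z, g z ∂μ);
    let lap : ℝ → (X → ℝ) → (X → ℝ) → ℝ := fun s f g =>
      ∫ t in Set.Ioi (0 : ℝ), Real.exp (-(s * t)) * corr f g t;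
    let e : Fin N → X → ℝ := fun x z => z.2 x ^ 2 / 2 + P.U (z.1 x) +
      ∑ j : Fin N, ((if j.val = x.val + 1 then P.V (z.1 j - z.1 x) / 2 else 0) +
        (if x.val = j.val + 1 then P.V (z.1 x - z.1 j) / 2 else 0));
    let G : ℝ → Matrix (Fin N) (Fin N) ℝ := fun s => Matrix.of fun x y => lap s (e x) (e y);
    let schur : ℝ → (X → ℝ) → (X → ℝ) → ℝ := fun s f g =>
      lap s f g - ∑ x : Fin N, ∑ y : Fin N, lap s f (e x) * (G s)⁻¹ x y * lap s (e y) g;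
    let J : X → ℝ := fun z => ∑ i : Fin N, P.bondCurrent N i z;
    ∀ b : Fin N, R ≤ b.val → b.val + 2 + R ≤ N → ∀ ρ ℓ : ℝ,
      Filter.Tendsto (fun s => schur s (P.bondCurrent N b) J) (nhdsWithin (0 : ℝ) (Set.Ioi 0)) (nhds ρ) →
      Filter.Tendsto (fun s => lap s (P.bondCurrent N b) J) (nhdsWithin (0 : ℝ) (Set.Ioi 0)) (nhds ℓ) →
      ℓ - δ ≤ ρ) →
    Summit.AtomisticToContinuum.FouriersLaw.Theses.HonestZwanzig.PositiveMemory :=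
  fun hCLB hB =>
    stub_positiveMemory_of_backflowFloor
      (stub_rowLimit Summit.AtomisticToContinuum.FouriersLaw.Theorems.HonestZwanzig.stub_feshbachIdentities) hCLB hB

/-- **The second child is implied by crux #2**: `OrthogonalOhm → BulkBackflowFloor` (landed
`stub_backflowFloor_of_orthogonalOhm`, p122152, fed `stub_feshbachIdentities` and `stub_rowLimit`). Along
`OrthogonalOhm`'s responses `ℓ = ∫₀^∞corr/(N−1) ≤ Σ_bρ_b/(N−1) ≤ k + ε + 2R(C+|k|+ε)/(N−1)` (`stub_upperLimit`) and
`ρ ≥ k − ε` on bulk bonds. -/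
theorem bulkBackflowFloor_of_orthogonalOhm :
    Summit.AtomisticToContinuum.FouriersLaw.Theses.HonestZwanzig.OrthogonalOhm →
    (∀ ω₂ lam β γ : ℝ, 0 < ω₂ → 0 < lam → 0 < β → 0 < γ → ∀ T : ℝ, 0 < T → ∀ δ : ℝ, 0 < δ → ∃ R : ℕ, ∀ N : ℕ, 2 ≤ N →
    let P := Literature.MathematicalPhysics.KineticTheory.HeatConduction.pinnedChain ω₂ lam β γ;
    let X := Literature.MathematicalPhysics.KineticTheory.HeatConduction.PhaseSpace N;
    let μ : MeasureTheory.Measure X := P.gibbsMeasure N T;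
    let corr : (X → ℝ) → (X → ℝ) → ℝ → ℝ := fun f g t =>
      (∫ z, f z * (∫ y, g y ∂(P.transitionKernel N T T t.toNNReal z)) ∂μ) - (∫ z, f z ∂μ) * (∫ z, g z ∂μ);
    let lap : ℝ → (X → ℝ) → (X → ℝ) → ℝ := fun s f g =>
      ∫ t in Set.Ioi (0 : ℝ), Real.exp (-(s * t)) * corr f g t;
    let e : Fin N → X → ℝ := fun x z => z.2 x ^ 2 / 2 + P.U (z.1 x) +
      ∑ j : Fin N, ((if j.val = x.val + 1 then P.V (z.1 j - z.1 x) / 2 else 0) +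
        (if x.val = j.val + 1 then P.V (z.1 x - z.1 j) / 2 else 0));
    let G : ℝ → Matrix (Fin N) (Fin N) ℝ := fun s => Matrix.of fun x y => lap s (e x) (e y);
    let schur : ℝ → (X → ℝ) → (X → ℝ) → ℝ := fun s f g =>
      lap s f g - ∑ x : Fin N, ∑ y : Fin N, lap s f (e x) * (G s)⁻¹ x y * lap s (e y) g;
    let J : X → ℝ := fun z => ∑ i : Fin N, P.bondCurrent N i z;
    ∀ b : Fin N, R ≤ b.val → b.val + 2 + R ≤ N → ∀ ρ ℓ : ℝ,
      Filter.Tendsto (fun s => schur s (P.bondCurrent N b) J) (nhdsWithin (0 : ℝ) (Set.Ioi 0)) (nhds ρ) →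
      Filter.Tendsto (fun s => lap s (P.bondCurrent N b) J) (nhdsWithin (0 : ℝ) (Set.Ioi 0)) (nhds ℓ) →
      ℓ - δ ≤ ρ) :=
  fun hOO =>
    stub_backflowFloor_of_orthogonalOhm
      Summit.AtomisticToContinuum.FouriersLaw.Theorems.HonestZwanzig.stub_feshbachIdentities
      (stub_rowLimit Summit.AtomisticToContinuum.FouriersLaw.Theorems.HonestZwanzig.stub_feshbachIdentities) hOO

/-- The re-assembled primary composition of line `Sketch` through the split:
`OrthogonalOhm → ConductanceLowerBound → PositiveMemory` (= the landed `PositiveMemory_of_notInsulating`, p120416,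
now factored as `PositiveMemory_of_subs hCLB (bulkBackflowFloor_of_orthogonalOhm hOO)`). -/
theorem PositiveMemory_of_subs'
    (hOO : Summit.AtomisticToContinuum.FouriersLaw.Theses.HonestZwanzig.OrthogonalOhm)
    (hCLB : Summit.AtomisticToContinuum.FouriersLaw.Theses.JunctionLocality.ConductanceLowerBound) :
    Summit.AtomisticToContinuum.FouriersLaw.Theses.HonestZwanzig.PositiveMemory :=
  PositiveMemory_of_subs hCLB (bulkBackflowFloor_of_orthogonalOhm hOO)

end Summit.AtomisticToContinuum.FouriersLaw.Theorems.HonestZwanzig.PositiveMemory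

end
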